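import Summits.BirchSwinnertonDyer.BirchSwinnertonDyer.Theorems.KimAtThreeDeepLowerExpStarOmegaPlace
import Literature.NumberTheory.EllipticCurves.TateModuleComparisonProofs
import Literature.NumberTheory.EllipticCurves.NeronOggShafarevichLocal
import Literature.NumberTheory.EllipticCurves.PotentialGoodReductionInertiaProofs
import HarnessLib

/-!
# A local Néron line EXISTS at every place `v ∣ p` of `ℚ`: `Nonempty (LocalNeronLineAt W p v)` from
# the construction statement `PAdicHodge.nonempty_neronDeRhamDatum` BY NAME
# (route `KimAtThreeKolyvagin`, rung W2; cell `bsd-addord`, seat w2-c2 gen 8; sequel of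
# `KimAtThreeDeepLowerExpStarOmega[Place]`)

HONEST FRAMING. Theorems only (no definition, no named fact, no `sorry`); nothing is closed or booked;
BSD is not proved by any of this.

The prequels define `exp*_ω` on `(tateLocalRep W p (Sum.inr v)).cohomology 1` along a local Néron line
`d : LocalNeronLineAt W p v`, a generator of `D⁰_dR(V_pW|_{Γ_{ℚ_v}})`, and DISPLAY its existence
(`Nonempty (LocalNeronLineAt W p v)` ⟺ `dim D⁰_dR(V_pW|_{Γ_{ℚ_v}}) = 1`). The tree's construction statement
`PAdicHodge.nonempty_neronDeRhamDatum` (p496885) gives a generator for the curve `W ×_ℚ ℚ_v` OVER `ℚ_v`,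
i.e. for the representation `V_p(W ×_ℚ ℚ_v)` of `Γ_{ℚ_v}` on the Tate module of the base change — a
DIFFERENT module. This file supplies the missing transport:

* `exists_rationalTateModule_equiv_baseChange_of_injective` — **`V_p(E_L) ≅ V_p(E)|_{Γ_L}` for ANY
  field extension `L/K`** (`char K = 0`, `E/K` elliptic): a `ℚ_p`-linear isomorphism
  `V_p(E) ≃ V_p(E_L)` intertwining `ρ_E ∘ (Γ_L → Γ_K)` and `ρ_{E_L}`. The tree's
  `WeierstrassCurve.exists_rationalTateModule_equiv_baseChange` (`TateModuleGaloisTransportProofs`)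
  assumes `L/K` ALGEBRAIC (all of `E(L̄)` then comes from `E(K̄)`); for a transcendental extension such
  as `ℚ_v/ℚ` only the TORSION of `E(L̄)` comes from `E(K̄)` — which is all `T_p` sees: the points map
  along the chosen `K̄ → L̄` is injective (`pointsMapOfEmb_injective`) with every torsion point in its
  range (`exists_pointsMapOfEmb_eq_of_nsmul_eq_zero`, Silverman *AEC* III.6.4: both sides have `m²`
  points), so `T_p` of it is bijective (`TateModule.map_bijective_of_injective_of_forall_mem_range`);
  equivariance is `localPointsEquivGeomPoints_pointsMapOfEmb_smul`, coordinatewise.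
  -- TODO(general form): this generalisation belongs next to the algebraic case in
  -- `Literature/NumberTheory/EllipticCurves/TateModuleGaloisTransportProofs.lean`.
* `nonempty_localNeronLineAt_of_nonempty_neronDeRhamDatum` — **the displayed existence of the line
  datum at `v ∣ p` follows from `nonempty_neronDeRhamDatum` BY NAME**: transport the Néron de Rham datum
  of `W ×_ℚ ℚ_v` back along the inverse isomorphism (`PeriodRingData.FilZeroLine.map`).

References: J.-P. Serre, *Abelian ℓ-adic representations* (1968), I §1.2 [Serre1968]; J. H. Silverman,
*AEC* (2009), III.§7, Cor. III.6.4 [SilvermanAEC2009]; K. Kato, LNM 1553 (1993), Ch. II Ex. 1.3.5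
[Kato1993LNM1553].
-/

set_option autoImplicit false
-- the Theorems namespace of a single-conjunct summit repeats the summit name by design (D-0017)
set_option linter.dupNamespace false

noncomputable section

open scoped TensorProduct NumberField
open Field ValuativeRel Function IsDedekindDomain NumberField
open Literature.NumberTheory.GaloisRepresentations
open Literature.NumberTheory.GaloisRepresentations.PeriodRingData
open Literature.NumberTheory.PAdicHodge
open Literature.NumberTheory.EllipticCurves
open Summit.BirchSwinnertonDyer.BirchSwinnertonDyer.Theorems.KimAtThreeDeepLowerExpStarOmega
open Summit.BirchSwinnertonDyer.BirchSwinnertonDyer.Theorems.KimAtThreeDeepLowerExpStarOmegaPlace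

namespace Summit.BirchSwinnertonDyer.BirchSwinnertonDyer.Theorems.KimAtThreeDeepLowerExpStarOmegaLine

universe u

/-! ### §1 `V_p(E_L) ≅ V_p(E)|_{Γ_L}` for an arbitrary extension `L/K` -/

section BaseChange

variable {K : Type u} [Field K] [CharZero K] (W : WeierstrassCurve K) [W.IsElliptic]
  (L : Type u) [Field L] [Algebra K L] (p : ℕ) [Fact p.Prime]

/-- **`V_p(E_L) ≅ V_p(E)|_{Γ_L}` for ANY field extension `L/K` of a characteristic-`0` field** (no
algebraicity): a `ℚ_p`-linear isomorphism `E : V_p(E) ≃ V_p(E_L)` with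
`E (ρ_E(res γ) x) = ρ_{E_L}(γ) (E x)` for all `γ ∈ Γ_L`. `T_p` only sees torsion, and all torsion of
`E(L̄)` comes from `E(K̄)` along the chosen `K̄ → L̄` (Silverman, *AEC*, Cor. III.6.4; the tree's
`exists_pointsMapOfEmb_eq_of_nsmul_eq_zero`). Serre (1968), I §1.2; Silverman, *AEC*, III.§7.
[cite: SilvermanAEC2009, III.§7 and Cor. III.6.4] -/
theorem exists_rationalTateModule_equiv_baseChange_of_injective :
    ∃ E : W.rationalTateModule p ≃ₗ[ℚ_[p]] (W.baseChange L).rationalTateModule p,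
      ∀ (γ : absoluteGaloisGroup L) (x : W.rationalTateModule p),
        E (W.rationalGaloisRepTate p (absGaloisRestrict K L γ) x) =
          (W.baseChange L).rationalGaloisRepTate p γ (E x) := by
  -- the points map `E(K̄) → E(L̄) = E_L(L̄)` along the chosen embedding
  set ι := absClosureEmbedding K L with hι
  set f : WeierstrassCurve.geomPoints W →+ WeierstrassCurve.geomPoints (W.baseChange L) :=
    (localPointsEquivGeomPoints W L).toAddMonoidHom.comp (pointsMapOfEmb W ι) with hf
  have hfinj : Function.Injective f :=
    (localPointsEquivGeomPoints W L).injective.comp (pointsMapOfEmb_injective W ι)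
  have hftors : ∀ b : WeierstrassCurve.geomPoints (W.baseChange L), ∀ n : ℕ, p ^ n • b = 0 →
      b ∈ f.range := by
    intro b n hb
    have hQ : p ^ n • (localPointsEquivGeomPoints W L).symm b = 0 := by
      rw [← map_nsmul, hb, map_zero]
    obtain ⟨P, -, hP⟩ := exists_pointsMapOfEmb_eq_of_nsmul_eq_zero W ι
      (pow_ne_zero n (Fact.out : p.Prime).ne_zero) hQ
    refine ⟨P, ?_⟩
    rw [hf, AddMonoidHom.comp_apply, hP, AddEquiv.coe_toAddMonoidHom, AddEquiv.apply_symm_apply]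
  have hfsmul : ∀ (γ : absoluteGaloisGroup L) (P : WeierstrassCurve.geomPoints W),
      f (absGaloisRestrict K L γ • P) = γ • f P := fun γ P => by
    rw [hf, AddMonoidHom.comp_apply, AddMonoidHom.comp_apply, AddEquiv.coe_toAddMonoidHom, hι]
    exact localPointsEquivGeomPoints_pointsMapOfEmb_smul W L γ P
  -- `T_p f` is bijective and equivariant
  set T : W.tateModule p →ₗ[ℤ_[p]] (W.baseChange L).tateModule p := TateModule.map p f with hT
  have hbij : Function.Bijective T :=
    TateModule.map_bijective_of_injective_of_forall_mem_range f hfinj hftors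
  let TE : W.tateModule p ≃ₗ[ℤ_[p]] (W.baseChange L).tateModule p := LinearEquiv.ofBijective T hbij
  have hTsmul : ∀ (γ : absoluteGaloisGroup L) (x : W.tateModule p),
      T (absGaloisRestrict K L γ • x) = γ • T x := by
    intro γ x
    refine TateModule.ext fun n => ?_
    rw [hT, TateModule.proj_map, TateModule.proj_smul_of_distribMulAction,
      TateModule.proj_smul_of_distribMulAction, TateModule.proj_map]
    exact hfsmul γ _
  refine ⟨TE.baseChange ℤ_[p] ℚ_[p] (W.tateModule p) ((W.baseChange L).tateModule p), fun γ => ?_⟩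
  suffices H : ∀ x : ℚ_[p] ⊗[ℤ_[p]] W.tateModule p,
      TE.baseChange ℤ_[p] ℚ_[p] (W.tateModule p) ((W.baseChange L).tateModule p)
          ((tateRepresentation (absoluteGaloisGroup K) (WeierstrassCurve.geomPoints W) p
            (absGaloisRestrict K L γ)).baseChange ℚ_[p] x) =
        (tateRepresentation (absoluteGaloisGroup L) (WeierstrassCurve.geomPoints (W.baseChange L)) p
            γ).baseChange ℚ_[p]
          (TE.baseChange ℤ_[p] ℚ_[p] (W.tateModule p) ((W.baseChange L).tateModule p) x) from
    fun x => H x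
  intro x
  induction x using TensorProduct.induction_on with
  | zero => simp only [map_zero]
  | tmul c t =>
    simp only [LinearEquiv.baseChange_tmul, LinearMap.baseChange_tmul, tateRepresentation_apply_apply]
    change c ⊗ₜ[ℤ_[p]] T (absGaloisRestrict K L γ • t) = c ⊗ₜ[ℤ_[p]] (γ • T t)
    rw [hTsmul]
  | add x y hx hy => simp only [map_add, hx, hy]

end BaseChange

/-! ### §2 The line datum at a place `v ∣ p` of `ℚ` from `nonempty_neronDeRhamDatum` -/

section AtPlace

variable (W : WeierstrassCurve ℚ) [W.IsElliptic] (p : ℕ) [Fact p.Prime]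
  (v : HeightOneSpectrum (𝓞 ℚ)) [hv : Fact (((p : ℕ) : 𝓞 ℚ) ∈ v.asIdeal)]

omit [Fact p.Prime] hv in
/-- **The base change `W ×_ℚ ℚ_v`**, named (like `galRestrictPlace`) BEFORE the local-field instances of
`ℚ_v` are switched on, so that its `ℚ`-algebra structure on `ℚ_v` is the tree's
`Place.instAlgebraCompletion`. [folklore] -/
abbrev baseChangePlace : WeierstrassCurve (Place.Completion (Sum.inr v : Place ℚ)) :=
  W.baseChange (Place.Completion (Sum.inr v : Place ℚ))

omit hv in
/-- `V_p(W ×_ℚ ℚ_v) ≅ V_p(W)|_{Γ_{ℚ_v}}` along `galRestrictPlace v` (§1 at `L = ℚ_v`). [cite: SilvermanAEC2009, III.§7 and Cor. III.6.4] -/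
theorem exists_rationalTateModule_equiv_baseChangePlace :
    ∃ E : W.rationalTateModule p ≃ₗ[ℚ_[p]] (baseChangePlace W v).rationalTateModule p,
      ∀ (γ : absoluteGaloisGroup (Place.Completion (Sum.inr v : Place ℚ))) (x : W.rationalTateModule p),
        E (W.rationalGaloisRepTate p (galRestrictPlace v γ) x) =
          (baseChangePlace W v).rationalGaloisRepTate p γ (E x) :=
  exists_rationalTateModule_equiv_baseChange_of_injective W (Place.Completion (Sum.inr v : Place ℚ)) p

attribute [local instance] valuativeRelPlace topologicalSpacePlace isNonarchimedeanLocalField_place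
  charZero_place padicAlgebraPlace fact_not_isUnit_place isAdicComplete_place

/-- **A local Néron line exists at every `v ∣ p`, from `PAdicHodge.nonempty_neronDeRhamDatum` BY NAME**:
the Néron de Rham datum of the base change `W ×_ℚ ℚ_v` (a generator of `D⁰_dR(V_p(W ×_ℚ ℚ_v))`,
Kato Ch. II Ex. 1.3.5 / Fontaine 1982) transported along the inverse of the restriction isomorphism
`V_p(W)|_{Γ_{ℚ_v}} ≅ V_p(W ×_ℚ ℚ_v)` of §1 (`PeriodRingData.FilZeroLine.map`). This DISCHARGES the displayed
existence hypothesis of the prequels' `exp*_ω` from the construction statement.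
[cite: Kato1993LNM1553, Ch. II Ex. 1.3.5 and §2.1.3] -/
theorem nonempty_localNeronLineAt_of_nonempty_neronDeRhamDatum (h : nonempty_neronDeRhamDatum) :
    Nonempty (LocalNeronLineAt W p v) := by
  obtain ⟨E, hE⟩ := exists_rationalTateModule_equiv_baseChangePlace W p v
  obtain ⟨d'⟩ := h (valuation_place_lt_one p v) (baseChangePlace W v)
  refine ⟨d'.map E.symm fun σ m => ?_⟩
  -- `E⁻¹` intertwines `ρ_{W ×_ℚ ℚ_v}(σ)` and `ρ_W(res σ)`
  apply E.injective
  rw [LinearEquiv.apply_symm_apply]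
  change (baseChangePlace W v).rationalGaloisRepTate p σ m =
    E (W.rationalGaloisRepTate p (galRestrictPlace v σ) (E.symm m))
  rw [hE, LinearEquiv.apply_symm_apply]

/-- Hence the `ℚ_v`-line `D⁰_dR(V_pW|_{Γ_{ℚ_v}})` has dimension `1` (`nonempty_localNeronLine_iff_finrank`).
[cite: Kato1993LNM1553, Ch. II Ex. 1.3.5] -/
theorem finrank_filD_localRationalTateRep_eq_one (h : nonempty_neronDeRhamDatum) :
    Module.finrank (Place.Completion (Sum.inr v : Place ℚ))
        ((bdRPeriodRingData (valuation_place_lt_one p v)).filD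
          (localRationalTateRep W p (galRestrictPlace v)) 0) = 1 :=
  (nonempty_localNeronLine_iff_finrank W (valuation_place_lt_one p v) (galRestrictPlace v)).1
    (nonempty_localNeronLineAt_of_nonempty_neronDeRhamDatum W p v h)

end AtPlace

end Summit.BirchSwinnertonDyer.BirchSwinnertonDyer.Theorems.KimAtThreeDeepLowerExpStarOmegaLine

end
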